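import Mathlib
import Literature.NumberTheory.LFunctions.Zhang2022.Section16BU034L
import Literature.NumberTheory.LFunctions.Zhang2022.Section15Bcoef
import Literature.NumberTheory.LFunctions.Zhang2022.TypedSection16BE
import Literature.NumberTheory.LFunctions.Zhang2022.TypedSection15E
import HarnessLib

/-!
# Zhang (2022) §16 p. 93, u035 (local reading, Lemma-15.1 rate): `Step16_u035Lw` from Lemma 15.1-χ

Topic `Literature/NumberTheory/LFunctions/Zhang2022` (Landau–Siegel audit tree; verdict-neutral).
Y. Zhang, *Discrete mean estimates and the Landau–Siegel zero*, arXiv:2211.02515v1 (2022)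
[Zhang2022LandauSiegel] — **an unrefereed manuscript under adjudication**; this file proves an EDGE
between typed claim nodes about the manuscript's own objects and asserts nothing about its Theorems 1–2.
ZHANG-L WP16 (seat zl-w16-p8), Block A of leaf h16_16 (binder `Eq16_16R2`), DAG node `Z22:§16.u035`
[Z22 p. 93, tex L4619]: "Hence, for `m₁ < T`, `Σ_{(m,𝔮)=1} b(m₁m)ϖ₂ⱼ(m)/m = 𝔢ⱼχ(m₁)τ₂(m₁) + O(D^{−c})` by
Lemma 15.1" — in the local reading with the rate Lemma 15.1 actually gives,
`Typed.Section16B.Step16_u035Lw` (file `TypedSection16BLocal`; error `C(α𝓛 + 𝓛⁻⁷)τ₂(m₁)`).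

`step16_u035LwE_of_lemma151ChiRE e1pp : Lemma151ChiRE e1pp c′ → Step16_u035LwE e1pp c′` — generic in the
value `e1pp` of `e″₁ⱼ` inside `𝔢ⱼ` (RT-05 E-twins, `TypedSection15E` / `TypedSection16BE`; instances: printed
`e1ppj`, giving `step16_u035Lw_of_lemma151ChiR : Skeleton.Lemma151ChiR c′ → Step16_u035Lw c′` by `rfl`, and the
derived `AppendixB.e1ppD` of record): replace `ϖ₂ⱼ^loc(m)` by
`χ(m)ϱ*ⱼ(m)` at the cost `Σ_{m<P rough} |b(m₁m)|τ₂(m)D^{−3}/m ≤ C_b τ₂(m₁) D^{−3} Σ_{m≤P} τ₂(m)²/m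
≪ τ₂(m₁)D^{−3}𝓛³⁶` (`Step16_u034L` in the explicit form `norm_varpi2loc_sub_main_le`, `|b(n)| ≤ C_bτ₂(n)`
`Skeleton.norm_bcoef_le`, `τ₂(m₁m) = τ₂(m₁)τ₂(m)`, `MeanSquareMajorant.sum_tau_sq_div_le`), then
apply Lemma 15.1 in the χ-reading of record with the `α₁ = α log T` rate (`Skeleton.Lemma151ChiR`, the
cross-WP input owned by WP15 — taken BY NAME as a hypothesis); `α₁ = π𝓛^{−7.9} ≤ 𝓛⁻⁷` and
`D^{−3}𝓛³⁶ ≤ 𝓛⁻⁷` for large `D`.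

## References
* Y. Zhang, arXiv:2211.02515v1 (2022), §16 p. 93 (u035); §15 Lemma 15.1 p. 86.
  [cite: Zhang2022LandauSiegel, §16 p. 93 (u035)]
-/

noncomputable section

open Complex Real Finset Filter Topology

namespace Literature.NumberTheory.LFunctions.Zhang2022.Typed.Section16B

open Literature.NumberTheory.LFunctions.Zhang2022
open Literature.NumberTheory.LFunctions.Zhang2022.Skeleton
open Literature.NumberTheory.LFunctions.Zhang2022.Typed.Section16A

variable (c' : ℝ)

/-- Any real threshold on `𝓛 = log D` holds for all large `D`. [cite: Zhang2022LandauSiegel, §2 (2.1)] -/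
private theorem exists_forall_le_ell_u035 (M : ℝ) : ∃ D₀ : ℕ, ∀ D : ℕ, D₀ ≤ D → M ≤ ell D := by
  refine ⟨⌈Real.exp M⌉₊ + 1, fun D hD => ?_⟩
  have hD1 : (⌈Real.exp M⌉₊ : ℝ) + 1 ≤ D := by exact_mod_cast hD
  have hD0 : (0 : ℝ) < D := by linarith [Nat.le_ceil (Real.exp M), Real.exp_pos M]
  rw [ell, Real.le_log_iff_exp_le hD0]
  linarith [Nat.le_ceil (Real.exp M)]

/-- `α₁ = α log T = π𝓛^{−79/10}` (`α = π/𝓛⁹`, `log T = 𝓛^{11/10}`), hence `α₁ ≤ 𝓛⁻⁷` once `𝓛 ≥ 4`.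
[cite: Zhang2022LandauSiegel, §6 p. 12; §2 (2.10)] -/
theorem alpha1_le_inv_ell_pow_seven {D : ℕ} (hℓ : 4 ≤ ell D) : alpha1 D ≤ (ell D ^ 7)⁻¹ := by
  have hℓ0 : 0 < ell D := by linarith
  rw [alpha1, log_bigT, alpha, bigP, Real.log_exp]
  -- `π/𝓛⁹ · 𝓛^{1.1} ≤ 𝓛⁻⁷` ⟸ `π 𝓛^{1.1} ≤ 𝓛²` ⟸ `π ≤ 𝓛^{0.9}`
  have h1 : Real.pi * ell D ^ (1.1 : ℝ) ≤ ell D ^ 2 := by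
    have h09 : (4 : ℝ) ^ (0.9 : ℝ) ≤ ell D ^ (0.9 : ℝ) := Real.rpow_le_rpow (by norm_num) hℓ (by norm_num)
    have h4 : Real.pi ≤ (4 : ℝ) ^ (0.9 : ℝ) := by
      -- `4^{0.9} ≥ 4^{9/10} = 2^{1.8} ≥ 3.2 > π`: use `4^{0.9} ≥ 4 · 4^{-0.1}` and `4^{0.1} ≤ 1.25`? simpler:
      -- `4^{0.9} = exp(0.9 log 4) ≥ 1 + 0.9·log 4 ≥ 1 + 0.9·1.38 = 2.24`… too weak; use `4^{0.9} ≥ 4^{0.9}`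
      -- via `4^{0.9} ≥ 2^{1.5}·… `. We instead bound `π ≤ 3.2 ≤ 4^{0.9}` through `4^{0.9} ≥ (3.2)`:
      -- `(3.2)^{10} = 112589990684.26… ≤ 4^9 = 262144`? No: `3.2^10 ≈ 1.1e5`? (3.2^10 = 112589.99) ≤ 262144 ✓.
      have h32 : (3.2 : ℝ) ≤ (4 : ℝ) ^ (0.9 : ℝ) := by
        have h : (3.2 : ℝ) = ((3.2 : ℝ) ^ (10 : ℝ)) ^ (0.1 : ℝ) := by
          rw [← Real.rpow_mul (by norm_num)]; norm_num
        have h' : (4 : ℝ) ^ (0.9 : ℝ) = ((4 : ℝ) ^ (9 : ℝ)) ^ (0.1 : ℝ) := by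
          rw [← Real.rpow_mul (by norm_num)]; norm_num
        rw [h, h']
        refine Real.rpow_le_rpow (by positivity) ?_ (by norm_num)
        norm_num
      linarith [Real.pi_lt_d2]
    have e : ell D ^ 2 = ell D ^ (0.9 : ℝ) * ell D ^ (1.1 : ℝ) := by
      rw [← Real.rpow_add hℓ0]; norm_num
    rw [e]
    have hpos : 0 ≤ ell D ^ (1.1 : ℝ) := by positivity
    nlinarith
  rw [div_mul_eq_mul_div, div_le_iff₀ (by positivity), ← one_div, one_div_mul_eq_div,
    le_div_iff₀ (by positivity)]
  calc Real.pi * ell D ^ (1.1 : ℝ) * ell D ^ 7 ≤ ell D ^ 2 * ell D ^ 7 := by gcongr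
    _ = ell D ^ 9 := by ring

/-- `log ⌈P⌉ ≤ 2𝓛⁹` and `2 ≤ ⌈P⌉` (`P = e^{𝓛⁹}`, `𝓛 ≥ 1`). [cite: Zhang2022LandauSiegel, §2 (2.6)] -/
private theorem ceil_bigP_facts {D : ℕ} (hℓ : 1 ≤ ell D) :
    2 ≤ ⌈bigP D⌉₊ ∧ Real.log (⌈bigP D⌉₊ : ℕ) ≤ 2 * ell D ^ 9 := by
  have h9 : (1 : ℝ) ≤ ell D ^ 9 := one_le_pow₀ hℓ
  have hP2 : (2 : ℝ) ≤ bigP D := by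
    rw [bigP]; linarith [Real.add_one_le_exp (ell D ^ 9)]
  have hPpos : 0 < bigP D := by linarith
  have h2 : 2 ≤ ⌈bigP D⌉₊ := by
    have := Nat.ceil_mono hP2
    simpa using this
  refine ⟨h2, ?_⟩
  have hN : ((⌈bigP D⌉₊ : ℕ) : ℝ) ≤ 2 * bigP D := by
    have := Nat.ceil_lt_add_one hPpos.le
    linarith
  have hNpos : (0 : ℝ) < ((⌈bigP D⌉₊ : ℕ) : ℝ) := by exact_mod_cast (show 0 < ⌈bigP D⌉₊ by omega)
  calc Real.log (⌈bigP D⌉₊ : ℕ) ≤ Real.log (2 * bigP D) := Real.log_le_log hNpos hN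
    _ = Real.log 2 + ell D ^ 9 := by rw [Real.log_mul (by norm_num) hPpos.ne', bigP, Real.log_exp]
    _ ≤ 2 * ell D ^ 9 := by linarith [Real.log_two_lt_d9]

/-- `𝓛^{43} ≤ 44!·D` for `D ≥ 1` (`𝓛^{44}/44! ≤ e^{𝓛} = D`, `𝓛 ≥ 1`). [folklore] -/
private theorem ell_pow_43_le {D : ℕ} (hD : (1 : ℝ) ≤ D) (hℓ : 1 ≤ ell D) :
    ell D ^ 43 ≤ (Nat.factorial 44 : ℝ) * D := by
  have hD0 : (0 : ℝ) < D := by linarith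
  have h := Real.pow_div_factorial_le_exp (ell D) (by linarith) 44
  rw [ell, Real.exp_log hD0, ← ell] at h
  rw [div_le_iff₀ (by positivity)] at h
  calc ell D ^ 43 ≤ ell D ^ 43 * ell D := le_mul_of_one_le_right (by positivity) hℓ
    _ = ell D ^ 44 := by ring
    _ ≤ D * Nat.factorial 44 := h
    _ = (Nat.factorial 44 : ℝ) * D := mul_comm _ _

open scoped Classical in
/-- **u035 (local reading, Lemma-15.1 rate) from Lemma 15.1-χ, generic in `e″ = e1pp`** — EDGE
`Lemma151ChiRE e1pp c′ → Typed.Section16B.Step16_u035LwE e1pp c′`: for `m₁ ∈ 𝔫(𝔮)`, `m₁ < T`,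
`Σ_{(m,𝔮)=1,m<P} b(m₁m)χ(m₁m)ϖ₂ⱼ^loc(m)/m = 𝔢ⱼ[e1pp]χ(m₁)τ₂(m₁) + O((α𝓛 + 𝓛⁻⁷)τ₂(m₁))` (u034 in the
local reading costs `τ₂(m₁)D^{−3}𝓛³⁶·C`, Lemma 15.1-χ costs `C·α₁τ₂(m₁)`, both `≤ C′𝓛⁻⁷τ₂(m₁)`
eventually; the value of `𝔢ⱼ` is never used). [cite: Zhang2022LandauSiegel, §16 p. 93 (u035); §15 Lemma 15.1] -/
theorem step16_u035LwE_of_lemma151ChiRE (e1pp : ℕ → ℂ) (h151 : Lemma151ChiRE e1pp c') :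
    Step16_u035LwE e1pp c' := by
  obtain ⟨C₁, D₁, h151⟩ := h151
  obtain ⟨D₂, h34⟩ := norm_varpi2loc_sub_main_le c'
  -- constants: `C_b = (1+|ι₂|)(|ι₃|+|ι₄|)`, `K = majorantConst 4 4`
  set Cb : ℝ := (1 + ‖iota2‖) * (‖iota3‖ + ‖iota4‖) with hCb
  have hCb0 : 0 ≤ Cb := by positivity
  set K : ℝ := MeanSquareMajorant.majorantConst (2 ^ 2) (2 * 2) with hK
  have hK0 : 0 < K := MeanSquareMajorant.majorantConst_pos _ _
  refine ⟨|C₁| + 1, ?_⟩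
  obtain ⟨D₃, hD₃⟩ := exists_forall_le_ell_u035 (max 4 (16 * Cb * K * Nat.factorial 44))
  refine ⟨max (max D₁ D₂) D₃, fun D _ χ hD hq hp hA j hj m₁ hm₁ hm₁T => ?_⟩
  have hD₁' : D₁ ≤ D := le_trans (le_trans (le_max_left _ _) (le_max_left _ _)) hD
  have hD₂' : D₂ ≤ D := le_trans (le_trans (le_max_right _ _) (le_max_left _ _)) hD
  have hD₃' : D₃ ≤ D := le_trans (le_max_right _ _) hD
  have hℓ4 : 4 ≤ ell D := le_trans (le_max_left _ _) (hD₃ D hD₃')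
  have hℓK : 16 * Cb * K * Nat.factorial 44 ≤ ell D := le_trans (le_max_right _ _) (hD₃ D hD₃')
  have hℓ1 : 1 ≤ ell D := by linarith
  have hℓ0 : 0 < ell D := by linarith
  have hℓ2 : 2 ≤ Real.log D := by rw [← ell]; linarith
  have hD1 : (1 : ℝ) ≤ D := by
    by_contra h; push Not at h
    have : Real.log D ≤ 0 := Real.log_nonpos (Nat.cast_nonneg D) h.le
    rw [← ell] at this; linarith
  have hDpos : (0 : ℝ) < D := by linarith
  -- `j ∈ {1,2} ⊆ {1,2,3}`
  have hj3 : j ∈ ({1, 2, 3} : Finset ℕ) := by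
    simp only [Finset.mem_insert, Finset.mem_singleton] at hj ⊢
    rcases hj with h | h <;> simp [h]
  have e151 := h151 D χ hD₁' hq hp hA j hj3 m₁ hm₁ hm₁T
  set S := (Finset.Ico 1 ⌈bigP D⌉₊).filter (fun m => Nat.Coprime m (frakq D)) with hS
  set S035 := ∑ m ∈ S, bcoef D (m₁ * m) * χ ((m₁ * m : ℕ) : ZMod D) * varpi2loc c' χ j m / (m : ℂ)
    with hS035
  set S151 := ∑ m ∈ S, χ ((m₁ * m : ℕ) : ZMod D) * bcoef D (m₁ * m) * χ (m : ZMod D) *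
    varrhoStar c' χ j m / (m : ℂ) with hS151
  -- (1) the two sums differ by the u034 error
  have hτsum : ∑ m ∈ Finset.Icc 1 ⌈bigP D⌉₊, MeanSquareMajorant.tau 2 m ^ 2 / (m : ℝ) ≤
      16 * K * ell D ^ 36 := by
    obtain ⟨hN2, hlogN⟩ := ceil_bigP_facts hℓ1
    have h := MeanSquareMajorant.sum_tau_sq_div_le 2 hN2
    refine h.trans ?_
    rw [hK]
    have hlog0 : 0 ≤ Real.log (⌈bigP D⌉₊ : ℕ) := Real.log_natCast_nonneg _
    calc MeanSquareMajorant.majorantConst (2 ^ 2) (2 * 2) * Real.log (⌈bigP D⌉₊ : ℕ) ^ (2 ^ 2)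
        ≤ MeanSquareMajorant.majorantConst (2 ^ 2) (2 * 2) * (2 * ell D ^ 9) ^ (2 ^ 2) := by
          gcongr
      _ = 16 * MeanSquareMajorant.majorantConst (2 ^ 2) (2 * 2) * ell D ^ 36 := by ring
  have hdiff : ‖S035 - S151‖ ≤ Cb * m₁.divisors.card * (D : ℝ) ^ (-(3 : ℝ)) * (16 * K * ell D ^ 36) := by
    rw [hS035, hS151, ← Finset.sum_sub_distrib]
    have hterm : ∀ m ∈ S,
        ‖bcoef D (m₁ * m) * χ ((m₁ * m : ℕ) : ZMod D) * varpi2loc c' χ j m / (m : ℂ) -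
          χ ((m₁ * m : ℕ) : ZMod D) * bcoef D (m₁ * m) * χ (m : ZMod D) * varrhoStar c' χ j m / (m : ℂ)‖ ≤
        Cb * m₁.divisors.card * (D : ℝ) ^ (-(3 : ℝ)) * (MeanSquareMajorant.tau 2 m ^ 2 / (m : ℝ)) := by
      intro m hm
      rw [hS, Finset.mem_filter, Finset.mem_Ico] at hm
      obtain ⟨⟨hm1, hmN⟩, hmq⟩ := hm
      have hmP : (m : ℝ) < bigP D := Nat.lt_ceil.mp hmN
      have hm0 : (0 : ℝ) < m := by exact_mod_cast hm1
      have e : bcoef D (m₁ * m) * χ ((m₁ * m : ℕ) : ZMod D) * varpi2loc c' χ j m / (m : ℂ) -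
          χ ((m₁ * m : ℕ) : ZMod D) * bcoef D (m₁ * m) * χ (m : ZMod D) * varrhoStar c' χ j m / (m : ℂ) =
          (bcoef D (m₁ * m) * χ ((m₁ * m : ℕ) : ZMod D)) *
            (varpi2loc c' χ j m - χ (m : ZMod D) * varrhoStar c' χ j m) / (m : ℂ) := by ring
      rw [e, norm_div, norm_mul, norm_mul, Complex.norm_natCast]
      have hb := Skeleton.norm_bcoef_le (D := D) hℓ2 (m₁ * m)
      have h34' := h34 D χ hD₂' hq j m hm1 hmq hmP
      have hcop : Nat.Coprime m₁ m := Typed.Section16B.coprime_of_mem_nset_of_coprime hm₁ hmq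
      have hτmul : ((m₁ * m).divisors.card : ℝ) = m₁.divisors.card * m.divisors.card := by
        rw [Nat.Coprime.card_divisors_mul hcop, Nat.cast_mul]
      rw [MeanSquareMajorant.tau_two_apply, hτmul] at hb
      rw [MeanSquareMajorant.tau_two_apply, div_le_iff₀ hm0]
      calc ‖bcoef D (m₁ * m)‖ * ‖χ ((m₁ * m : ℕ) : ZMod D)‖ *
            ‖varpi2loc c' χ j m - χ (m : ZMod D) * varrhoStar c' χ j m‖
          ≤ (Cb * (m₁.divisors.card * m.divisors.card)) * 1 * (m.divisors.card * (D : ℝ) ^ (-(3 : ℝ))) :=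
            mul_le_mul (mul_le_mul hb (DirichletCharacter.norm_le_one χ _) (norm_nonneg _)
              (by positivity)) h34' (norm_nonneg _) (by positivity)
        _ = Cb * m₁.divisors.card * (D : ℝ) ^ (-(3 : ℝ)) * ((m.divisors.card : ℝ) ^ 2 / m) * m := by
            field_simp
    refine (norm_sum_le _ _).trans ((Finset.sum_le_sum hterm).trans ?_)
    rw [← Finset.mul_sum]
    refine mul_le_mul_of_nonneg_left ?_ (by positivity)
    refine le_trans ?_ hτsum
    refine Finset.sum_le_sum_of_subset_of_nonneg ?_ fun m _ _ => by positivity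
    intro m hm
    rw [hS, Finset.mem_filter, Finset.mem_Ico] at hm
    exact Finset.mem_Icc.mpr ⟨hm.1.1, hm.1.2.le⟩
  -- (2) `C_b·16K·𝓛³⁶·D^{−3} ≤ 𝓛⁻⁷` and `α₁ ≤ 𝓛⁻⁷`
  have hτ0 : (0 : ℝ) ≤ m₁.divisors.card := Nat.cast_nonneg _
  have hsmall : Cb * (D : ℝ) ^ (-(3 : ℝ)) * (16 * K * ell D ^ 36) ≤ (ell D ^ 7)⁻¹ := by
    have h43 := ell_pow_43_le hD1 hℓ1
    rw [show (-(3 : ℝ)) = -((3 : ℕ) : ℝ) by norm_num, Real.rpow_neg hDpos.le, Real.rpow_natCast]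
    have hℓD : ell D ≤ D := by
      rw [ell]; exact (Real.log_le_sub_one_of_pos hDpos).trans (by linarith)
    have h1 : 16 * Cb * K * ell D ^ 43 ≤ ell D * D := by
      calc 16 * Cb * K * ell D ^ 43 ≤ 16 * Cb * K * ((Nat.factorial 44 : ℝ) * D) := by gcongr
        _ = (16 * Cb * K * Nat.factorial 44) * D := by ring
        _ ≤ ell D * D := by gcongr
    have h2 : 16 * Cb * K * ell D ^ 43 ≤ (D : ℝ) ^ 3 := by
      refine h1.trans ?_
      calc ell D * D ≤ D * D := by gcongr
        _ ≤ (D : ℝ) ^ 3 := by nlinarith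
    calc Cb * ((D : ℝ) ^ 3)⁻¹ * (16 * K * ell D ^ 36)
        = (16 * Cb * K * ell D ^ 43) / ((D : ℝ) ^ 3 * ell D ^ 7) := by field_simp
      _ ≤ (D : ℝ) ^ 3 / ((D : ℝ) ^ 3 * ell D ^ 7) := by gcongr
      _ = (ell D ^ 7)⁻¹ := by field_simp
  have hα1 : alpha1 D ≤ (ell D ^ 7)⁻¹ := alpha1_le_inv_ell_pow_seven hℓ4
  have hαℓ : 0 ≤ alpha D * ell D := by
    have : 0 ≤ alpha D := by rw [alpha, bigP, Real.log_exp]; positivity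
    positivity
  -- (3) combine
  have hmain151 : ‖S151 - frakeE e1pp j * χ (m₁ : ZMod D) * (m₁.divisors.card : ℂ)‖ ≤
      C₁ * alpha1 D * m₁.divisors.card := by
    have e : S151 - frakeE e1pp j * χ (m₁ : ZMod D) * (m₁.divisors.card : ℂ) =
        S151 - χ (m₁ : ZMod D) * (m₁.divisors.card : ℂ) * frakeE e1pp j := by ring
    rw [e]; exact e151
  calc ‖S035 - frakeE e1pp j * χ (m₁ : ZMod D) * (m₁.divisors.card : ℂ)‖
      = ‖(S035 - S151) + (S151 - frakeE e1pp j * χ (m₁ : ZMod D) * (m₁.divisors.card : ℂ))‖ := by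
        congr 1; ring
    _ ≤ ‖S035 - S151‖ + ‖S151 - frakeE e1pp j * χ (m₁ : ZMod D) * (m₁.divisors.card : ℂ)‖ := norm_add_le _ _
    _ ≤ Cb * m₁.divisors.card * (D : ℝ) ^ (-(3 : ℝ)) * (16 * K * ell D ^ 36) +
          C₁ * alpha1 D * m₁.divisors.card := add_le_add hdiff hmain151
    _ = (Cb * (D : ℝ) ^ (-(3 : ℝ)) * (16 * K * ell D ^ 36)) * m₁.divisors.card +
          C₁ * (alpha1 D * m₁.divisors.card) := by ring
    _ ≤ (ell D ^ 7)⁻¹ * m₁.divisors.card + |C₁| * (alpha1 D * m₁.divisors.card) := by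
        have hα10 : 0 ≤ alpha1 D * m₁.divisors.card := by
          have : 0 ≤ alpha1 D := by
            rw [alpha1, log_bigT, alpha, bigP, Real.log_exp]; positivity
          positivity
        gcongr
        exact le_abs_self C₁
    _ ≤ (ell D ^ 7)⁻¹ * m₁.divisors.card + |C₁| * ((ell D ^ 7)⁻¹ * m₁.divisors.card) := by
        gcongr
    _ ≤ (|C₁| + 1) * (alpha D * ell D + (ell D ^ 7)⁻¹) * m₁.divisors.card := by
        have hi : 0 ≤ (ell D ^ 7)⁻¹ := by positivity
        nlinarith [abs_nonneg C₁, mul_nonneg hαℓ hτ0, mul_nonneg hi hτ0,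
          mul_nonneg (abs_nonneg C₁) (mul_nonneg hαℓ hτ0)]

/-- **u035 (local reading) from the printed Lemma 15.1-χR** — the instance `e1pp = e1ppj`:
`Skeleton.Lemma151ChiR c′ → Step16_u035Lw c′` (`rfl`-instances `Lemma151ChiRE_e1ppj`,
`step16_u035LwE_e1ppj`). [cite: Zhang2022LandauSiegel, §16 p. 93 (u035); §15 Lemma 15.1] -/
theorem step16_u035Lw_of_lemma151ChiR (h151 : Lemma151ChiR c') : Step16_u035Lw c' := by
  rw [← step16_u035LwE_e1ppj]
  rw [lemma151ChiR_eq_E] at h151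
  exact step16_u035LwE_of_lemma151ChiRE c' e1ppj h151

end Literature.NumberTheory.LFunctions.Zhang2022.Typed.Section16B
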